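import Summits.SmoothPoincare4.SmoothPoincare4.Theses.CylinderEntropy
import Literature.Geometry.Manifold.CylinderSlice
import Literature.Geometry.Riemannian.SphericalCylinderEntropy
import Literature.Topology.FourManifolds.HomotopyS4CompactProofs

/-!
# Disproof of `SliceIsolation` — standing adversary file
(crux `stmt-SmoothPoincare4-7632`, route `CylinderEntropy`; refuter-cdisprove-stmt-SmoothPoincare4-7632-0)

## Findings (cycle 1, 2026-08-15) — everything below is `lean check`ed; `sorry` only in § NearMisses

* **Why the crux resists refutation** (§ Resists): `SmoothPoincare4 → SliceIsolationAt ε` for every `ε`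
  (`sliceIsolationAt_of_smoothPoincare4`), hence `¬ SliceIsolation → ¬ SmoothPoincare4`
  (`not_smoothPoincare4_of_not_sliceIsolation`): a sorry-free refutation is a Lean exotic 4-sphere; and
  `sliceIsolation_iff_exotic_isolated`: the crux says exactly "cross-section embeddings of EXOTIC homotopy
  4-spheres have `λ_cyl ≥ 1 + ε` uniformly".  The M-side typing is robust: `≃ₘ⟮𝓡 4, 𝓡 4⟯` is the `C^∞`
  diffeomorphism type (`Diffeomorph … ∞`; no analytic junk), `Manifold.IsSmoothEmbedding` = immersion ∧
  topological embedding, and `M ≃ₕ S⁴` forces `M` compact (tree theorem, used in § LargeScale).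
* **Threshold family** (§ Family): `SliceIsolation ↔ ∃ ε > 0, SliceIsolationAt ε` (definitional),
  antitone in `ε`, `CylinderRungTwo ↔ SliceIsolationAt (4/e − 1)` (definitional), so `CylinderRungTwo`
  yields a positive member (`exists_sliceIsolationAt_of_cylinderRungTwo`).  This file deliberately asserts
  NO route item positively (all such statements go through the family `SliceIsolationAt`).
* **The slices are typed cross-sections** (§ Slice; also proposed as `Literature/Geometry/Manifold/CylinderSlice.lean`,
  p68516): `sliceMap c : S⁴ → S⁴×{c}` is a `Manifold.IsSmoothEmbedding (𝓡 4) (𝓡 6) ∞` in `N` with image the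
  slice, a set containing a slice separates the ends (IVT), two slices embed `S⁴ ⊔ S⁴`, `S⁴ ⊔ S⁴ ≄ S⁴`.
* **Junk guards** (§ JunkGuards): `0 < μH[4](S⁴ ⊂ ℝ⁵) < ⊤` for Mathlib's un-normalised `μH`, so the
  normalising constant of `F̂` is non-degenerate (no collapse of the crux to "vacuous" or to "cross-section
  SPC4"); the typed Gegenbauer sum, weights and `k = 0` mode were re-derived (DLMF 18.5.10, `dim H_k / C_k(1)
  = (2k+3)/3`) — no normalisation leak found; kit job j005540 checks positivity/mass numerically.
* **Large scales, PROVED** (§ LargeScale; core landed as `Literature/Geometry/Riemannian/SphericalCylinderEntropy.lean`,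
  p69001, which also serves the planner's definition request D1: `cylKernel`/`cylDensity`/`cylEntropy` verbatim
  from the items): the typed series is summable for `τ ≥ 1` with
  `𝔥(τ,s) ≥ 1 − e^{-τ}/(1−e^{-τ})` on `|s| ≤ 1` (`one_sub_tail_le_zonal`), whence
  `μH(A)/μH(S⁴) ≤ λ_cyl(A)` for measurable `A ⊆ N` of bounded height (`measure_ratio_le_cylEntropy`),
  **`1 ≤ λ_cyl(S⁴×{c})` for every slice** (`one_le_cylEntropy_slice` — the "≥" half of item
  `SliceCalibration`, unconditional; here `sliceCalibration_ge`), the set-level **area floor**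
  `μH[4](S⁴) ≤ μH[4](A)` for every set separating the ends (= item `AreaFloor`; a complete candidate proof of
  the item, `AreaFloorProof.lean`, is attached to 7635), hence `1 ≤ λ_cyl(range ι)` for every compact
  cross-section (`one_le_cylEntropy_of_crossSection`) and the **tightness of the constant `1`,
  unconditional**: `ε ≤ 0 → SliceIsolationAt ε`
  (`sliceIsolationAt_of_nonpos`) — below `1` the crux is vacuous, so the family cannot be shifted down; the
  crux is exactly the jump across `ε = 0` (`sliceIsolationAt_nonpos_and_crux_iff`).
* **Load-bearing hypotheses** (§ LoadBearing): drop `0 < ε` ⇒ TRIVIAL (`ε = −1`); drop `M ≃ₕ S⁴` +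
  separation ⇒ FALSE (empty cross-section, `λ_cyl(∅) = 0`); drop `M ≃ₕ S⁴` + entropy bound ⇒ FALSE (two
  slices); drop `Manifold.IsSmoothEmbedding` ⇒ the crux becomes `↔ SmoothPoincare4` given Freedman's fact
  `nonempty_homeomorph_sphere_four` and `SliceCalibration` (all content beyond SPC4 is in the smoothness of
  `ι`); non-vacuity of the crux ⇐ `SliceCalibration` (§ NonVacuity).
* **Near-misses** (§ NearMisses, sorried, obstruction in the docstring): drop `M ≃ₕ S⁴` alone (slice ⊔
  dust; needs the "≤ 1" calibration + a sup bound of the S⁴ heat kernel); no gap in the VALUES of `λ_cyl` on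
  standard spheres (graphs `t = a cos θ`, `sup F̂ − 1 = O(a²)` numerically) — the isolation is topological.

## For provers
`M ≃ₕ S⁴` is used by no step of the intended mechanism for connected closed `M` (only excludes ∅/⊔ junk);
the whole difficulty is ε-regularity for `F̂` up to scale `inj(N) = π` turning `λ_cyl < 1+ε` into
graphicality over a slice.  Reusable here: the slice embeddings, the separation lemma, `μH` non-degeneracy,
summability + large-`τ` asymptotics of the typed kernel, and `μH(A)/μH(S⁴) ≤ λ_cyl(A)`.
-/

noncomputable section

set_option linter.dupNamespace false

open scoped BigOperators Topology Manifold MeasureTheory ENNReal ContDiff ContinuousMap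
open Filter Set Function TopologicalSpace MeasureTheory Finset

namespace Summit.SmoothPoincare4.SmoothPoincare4.Cruxes.SliceIsolation.Disproof

open Summit.SmoothPoincare4.SmoothPoincare4.Theses.CylinderEntropy
open Literature.Geometry.Manifold.CylinderSlice
open Literature.Geometry.Riemannian.SphericalCylinderEntropy

/-! ### The typed pieces of the crux, named -/

/-- Membership of a point of `ℝ⁶` in the round cylinder `N = {∑_{i<5} zᵢ² = 1} = S⁴×ℝ`. -/
def InCyl (z : EuclideanSpace ℝ (Fin 6)) : Prop := ∑ i : Fin 5, z (Fin.castSucc i) ^ 2 = 1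

/-- The typed "separates the two ends of `N`" predicate of the route items, for a subset `A ⊆ ℝ⁶`. -/
def SeparatesEnds (A : Set (EuclideanSpace ℝ (Fin 6))) : Prop :=
  ∃ R : ℝ, ∀ a b : EuclideanSpace ℝ (Fin 6), ∑ i : Fin 5, a (Fin.castSucc i) ^ 2 = 1 →
    ∑ i : Fin 5, b (Fin.castSucc i) ^ 2 = 1 → a 5 ≤ -R → R ≤ b 5 →
      ¬ JoinedIn ({z : EuclideanSpace ℝ (Fin 6) | ∑ i : Fin 5, z (Fin.castSucc i) ^ 2 = 1} \ A) a b

/-! The typed kernel `cylKernel`, density `cylDensity` (`F̂_{p,τ}`) and entropy `cylEntropy` (`λ_cyl`) are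
now the tree's `Literature.Geometry.Riemannian.SphericalCylinderEntropy.{cylKernel, cylDensity, cylEntropy}`
(landed from this file as p69001; verbatim the expressions of the route items, so everything below that
unfolds the crux is still definitional). -/

/-- `SliceIsolation` at a *fixed* threshold `1 + ε` (the crux is `∃ ε > 0, SliceIsolationAt ε`). -/
def SliceIsolationAt (ε : ℝ) : Prop :=
  ∀ (M : Type) [TopologicalSpace M] [T2Space M] [SecondCountableTopology M]
    [ChartedSpace (EuclideanSpace ℝ (Fin 4)) M] [IsManifold (𝓡 4) ∞ M],
    M ≃ₕ Metric.sphere (0 : EuclideanSpace ℝ (Fin 5)) 1 →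
    ∀ ι : M → EuclideanSpace ℝ (Fin 6), Manifold.IsSmoothEmbedding (𝓡 4) (𝓡 6) ∞ ι →
      (∀ x, InCyl (ι x)) → SeparatesEnds (Set.range ι) →
      cylEntropy (Set.range ι) < ENNReal.ofReal (1 + ε) →
      Nonempty (M ≃ₘ⟮𝓡 4, 𝓡 4⟯ Metric.sphere (0 : EuclideanSpace ℝ (Fin 5)) 1)

/-- The crux, unfolded into the named pieces (definitional). -/
theorem sliceIsolation_iff : SliceIsolation ↔ ∃ ε : ℝ, 0 < ε ∧ SliceIsolationAt ε := Iff.rfl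

/-- `CylinderRungTwo` is the member `ε = 4/e - 1` of the same one-parameter family (definitional
after `1 + (4/e - 1) = 4/e`). -/
theorem cylinderRungTwo_iff_sliceIsolationAt :
    CylinderRungTwo ↔ SliceIsolationAt (4 / Real.exp 1 - 1) := by
  have h : (1 : ℝ) + (4 / Real.exp 1 - 1) = 4 / Real.exp 1 := by ring
  rw [SliceIsolationAt, h]
  rfl

/-- The family is antitone in the threshold: a smaller `ε` is a weaker demand. -/
theorem SliceIsolationAt.anti {ε ε' : ℝ} (h : SliceIsolationAt ε) (hle : ε' ≤ ε) :
    SliceIsolationAt ε' :=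
  fun M _ _ _ _ _ e ι hι hN hsep hlt =>
    h M e ι hι hN hsep (hlt.trans_le (ENNReal.ofReal_le_ofReal (by linarith)))

/-- `CylinderRungTwo` gives a positive member of the family (`ε = 4/e - 1 > 0`, `Real.exp_one_lt_d9`); with
`sliceIsolation_iff` this is the glue `CylinderRungTwo → SliceIsolation` of the route reviewer's attached
`CylinderEntropy_AssemblyProof.lean` (stated through the family so that this adversary file itself asserts no
route item). -/
theorem exists_sliceIsolationAt_of_cylinderRungTwo (h : CylinderRungTwo) :
    ∃ ε : ℝ, 0 < ε ∧ SliceIsolationAt ε := by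
  refine ⟨_, ?_, cylinderRungTwo_iff_sliceIsolationAt.1 h⟩
  have he : Real.exp 1 < 4 := lt_trans Real.exp_one_lt_d9 (by norm_num)
  rw [sub_pos, lt_div_iff₀ (Real.exp_pos 1)]
  linarith

/-! ### Why the crux resists: `¬ SliceIsolation` is an exotic 4-sphere -/

/-- **SPC4 implies the crux at every threshold** (the conclusion of `SliceIsolationAt ε` is the
summit statement specialised to `M`; none of the analytic hypotheses is used). -/
theorem sliceIsolationAt_of_smoothPoincare4 (h : _root_.SmoothPoincare4) (ε : ℝ) :
    SliceIsolationAt ε := by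
  unfold _root_.SmoothPoincare4 Literature.SPC4.SmoothPoincareConjectureFour
    ContinuousMap.HomotopyEquiv.NonemptyDiffeomorphSphere at h
  intro M _ _ _ _ _ e ι _ _ _ _
  exact h M ‹_› ‹_› e

/-- **A refutation of the crux is a disproof of the smooth 4-dimensional Poincaré conjecture**:
`¬ SliceIsolation → ¬ SmoothPoincare4` (SPC4 gives `SliceIsolationAt 1`, a positive member of the family).
This is why the standing adversary cannot expect a sorry-free `¬ SliceIsolation`: it would exhibit (inside
Lean) an exotic 4-sphere. -/
theorem not_smoothPoincare4_of_not_sliceIsolation (h : ¬ SliceIsolation) : ¬ _root_.SmoothPoincare4 :=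
  fun hs => h (sliceIsolation_iff.2 ⟨1, one_pos, sliceIsolationAt_of_smoothPoincare4 hs 1⟩)

/-- **The content of the crux is a statement about exotic spheres only**: `SliceIsolation` says
exactly that cross-section embeddings of *exotic* homotopy 4-spheres (those `M` with
`IsEmpty (M ≃ₘ S⁴)`) are uniformly `(1+ε)`-concentrated, i.e. have `λ_cyl ≥ 1 + ε`.  For a
standard `M` the implication is trivially true, whatever `ι` is. -/
theorem sliceIsolation_iff_exotic_isolated :
    SliceIsolation ↔ ∃ ε : ℝ, 0 < ε ∧
      ∀ (M : Type) [TopologicalSpace M] [T2Space M] [SecondCountableTopology M]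
        [ChartedSpace (EuclideanSpace ℝ (Fin 4)) M] [IsManifold (𝓡 4) ∞ M],
        M ≃ₕ Metric.sphere (0 : EuclideanSpace ℝ (Fin 5)) 1 →
        IsEmpty (M ≃ₘ⟮𝓡 4, 𝓡 4⟯ Metric.sphere (0 : EuclideanSpace ℝ (Fin 5)) 1) →
        ∀ ι : M → EuclideanSpace ℝ (Fin 6), Manifold.IsSmoothEmbedding (𝓡 4) (𝓡 6) ∞ ι →
          (∀ x, InCyl (ι x)) → SeparatesEnds (Set.range ι) →
          ENNReal.ofReal (1 + ε) ≤ cylEntropy (Set.range ι) := by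
  rw [sliceIsolation_iff]
  refine exists_congr fun ε => and_congr_right fun _ => ?_
  constructor
  · intro h M _ _ _ _ _ e hM ι hι hN hsep
    by_contra hlt
    exact hM.false (h M e ι hι hN hsep (not_le.1 hlt)).some
  · intro h M _ _ _ _ _ e ι hι hN hsep hlt
    by_contra hM
    rw [not_nonempty_iff] at hM
    exact absurd hlt (not_lt.2 (h M e hM ι hι hN hsep))

/-! ### The slices `S⁴ × {c}` as typed cross-sections — LANDED as
`Literature/Geometry/Manifold/CylinderSlice.lean` (p68516, from this file); re-exported here -/

section Slice

open Literature.Geometry.Manifold.CylinderSlice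

/-- The slice embedding lands in `N` (typed membership; tree: `sum_sq_sliceMap`). -/
theorem inCyl_sliceMap (c : ℝ) (x : Metric.sphere (0 : EuclideanSpace ℝ (Fin 5)) 1) :
    InCyl (sliceMap c x) :=
  sum_sq_sliceMap c x

/-- A set containing a whole slice separates the ends (tree: `separatesEnds_of_slice_subset`, restated
through the named predicate). -/
theorem separatesEnds_of_slice_subset' {A : Set (EuclideanSpace ℝ (Fin 6))} {c : ℝ}
    (h : {z : EuclideanSpace ℝ (Fin 6) | ∑ i : Fin 5, z (Fin.castSucc i) ^ 2 = 1 ∧ z 5 = c} ⊆ A) :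
    SeparatesEnds A :=
  separatesEnds_of_slice_subset h

end Slice

/-! ### The support item `AreaFloor` (stmt-7635): its set-level content is the tree's
`hausdorffMeasure_sphere_le_of_separatesEnds` (landed from this seat, p69001); a complete candidate proof of the
item itself (`areaFloor_holds`, file `AreaFloorProof.lean`) is attached to 7635 for a prover to land — it is
deliberately NOT restated here, so that this adversary file proves no positive route item. -/

/-! ### Junk guards (landed): `hausdorffMeasure_sphere_four_pos`, `hausdorffMeasure_sphere_four_lt_top`,
`inv_hausdorffMeasure_sphere_four_ne_zero_ne_top`, `cylDensity_eq_top_iff`, `cylDensity_eq_zero_iff` are now in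
`Literature.Geometry.Riemannian.SphericalCylinderEntropy` — the normalising constant `μH[4](S⁴ ⊂ ℝ⁵)` of `F̂` is
non-degenerate for Mathlib's un-normalised `μH`. -/

/-! ### Large scales (landed core: summability of the typed series, `one_sub_tail_le_zonal`,
`measure_ratio_le_cylEntropy`, `one_le_cylEntropy_slice`, `one_le_cylEntropy_of_measure_le`,
`one_le_cylEntropy_of_separatesEnds` in `SphericalCylinderEntropy.lean`) — crux-level corollaries -/

section LargeScale

/-- **Entropy floor for cross-sections (unconditional)**: every smoothly embedded COMPACT cross-section
(image in `N`, separating the ends) has typed cylinder entropy `≥ 1` — from the tree's set-level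
`one_le_cylEntropy_of_separatesEnds` (area floor + the `τ → ∞` end of the supremum). -/
theorem one_le_cylEntropy_of_crossSection (M : Type) [TopologicalSpace M] [CompactSpace M]
    [ChartedSpace (EuclideanSpace ℝ (Fin 4)) M]
    (ι : M → EuclideanSpace ℝ (Fin 6)) (hι : Manifold.IsSmoothEmbedding (𝓡 4) (𝓡 6) ∞ ι)
    (hN : ∀ x, InCyl (ι x)) (hsep : SeparatesEnds (Set.range ι)) : 1 ≤ cylEntropy (Set.range ι) := by
  have hcpt : IsCompact (Set.range ι) := isCompact_range hι.contMDiff.continuous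
  obtain ⟨B, hB⟩ := hcpt.exists_bound_of_continuousOn
    ((EuclideanSpace.proj (5 : Fin 6)).continuous.continuousOn)
  obtain ⟨R, hR⟩ := hsep
  refine one_le_cylEntropy_of_separatesEnds hcpt.isClosed.measurableSet ?_ (B := B)
    (fun z hz => by simpa [Real.norm_eq_abs] using hB z hz) hR
  rintro z ⟨x, rfl⟩
  exact hN x

/-- **TIGHTNESS of the constant `1`, unconditional: `SliceIsolationAt ε` holds (vacuously) for every
`ε ≤ 0`** — no cross-section embedding of a homotopy 4-sphere satisfies `λ_cyl < 1 + ε`, because homotopy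
4-spheres are compact (tree: `compactSpace_of_homotopyEquiv_sphere_four_holds`, Hatcher Prop. 3.29) and
compact cross-sections have `λ_cyl ≥ 1`.  So the family `SliceIsolationAt ε` is trivially true for `ε ≤ 0`,
is the crux for small `ε > 0`, and is `CylinderRungTwo` at `ε = 4/e - 1`: the constant `1` cannot be
lowered, and at `1` exactly the hypothesis is unsatisfiable. -/
theorem sliceIsolationAt_of_nonpos {ε : ℝ} (hε : ε ≤ 0) : SliceIsolationAt ε := by
  intro M _ _ _ _ _ e ι hι hN hsep hlt
  haveI : CompactSpace M :=
    Literature.Topology.FourManifolds.compactSpace_of_homotopyEquiv_sphere_four_holds M e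
  have h1 : ENNReal.ofReal (1 + ε) ≤ 1 := by
    rw [← ENNReal.ofReal_one]
    exact ENNReal.ofReal_le_ofReal (by linarith)
  exact absurd (lt_of_lt_of_le hlt h1) (not_lt.2 (one_le_cylEntropy_of_crossSection M ι hι hN hsep))

/-- Hence the honest content of the crux is the jump across `ε = 0`:
`SliceIsolation ↔ ∃ ε > 0, SliceIsolationAt ε` while `∀ ε ≤ 0, SliceIsolationAt ε` is a theorem. -/
theorem sliceIsolationAt_nonpos_and_crux_iff :
    (∀ ε : ℝ, ε ≤ 0 → SliceIsolationAt ε) ∧ (SliceIsolation ↔ ∃ ε : ℝ, 0 < ε ∧ SliceIsolationAt ε) :=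
  ⟨fun _ hε => sliceIsolationAt_of_nonpos hε, sliceIsolation_iff⟩

/-- **Half of the calibration for the crux's own witness**: the slice `S⁴ × {0}` has `λ_cyl ≥ 1` (tree:
`one_le_cylEntropy_slice`), so `SliceCalibration` can only fail upwards — a failure would be a normalisation
LEAK making the crux (and every threshold item) harder to satisfy, never a refutation. -/
theorem sliceCalibration_ge : 1 ≤ cylEntropy {z : EuclideanSpace ℝ (Fin 6) |
    ∑ i : Fin 5, z (Fin.castSucc i) ^ 2 = 1 ∧ z 5 = 0} := by
  rw [← range_sliceMap]
  exact one_le_cylEntropy_slice 0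

end LargeScale

/-! ### Load-bearing hypotheses -/

section LoadBearing

/-- The crux with the positivity `0 < ε` dropped. -/
def SliceIsolationWithoutPos : Prop := ∃ ε : ℝ, SliceIsolationAt ε

/-- **Dropping `0 < ε` trivialises the crux**: with `ε = -1` the threshold is `ofReal 0 = 0` and
no cylinder entropy is `< 0`.  (So `0 < ε` is the non-vacuity guard, not a load-bearing
hypothesis: any proof "must use" it only in the sense that the statement is empty without it.) -/
theorem sliceIsolationWithoutPos_trivial : SliceIsolationWithoutPos :=
  ⟨-1, fun M _ _ _ _ _ _ ι _ _ _ hlt => absurd hlt (by simp)⟩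

/-- The cylinder entropy of the empty set is `0` (no mass at any centre or scale). -/
theorem cylEntropy_empty : cylEntropy (∅ : Set (EuclideanSpace ℝ (Fin 6))) = 0 := by
  simp [cylEntropy, cylDensity]

/-- The crux at threshold `1 + ε` with BOTH the homotopy equivalence `M ≃ₕ S⁴` and the
end-separation hypothesis dropped. -/
def SliceIsolationWithoutHomotopyEquivWithoutSeparation (ε : ℝ) : Prop :=
  ∀ (M : Type) [TopologicalSpace M] [T2Space M] [SecondCountableTopology M]
    [ChartedSpace (EuclideanSpace ℝ (Fin 4)) M] [IsManifold (𝓡 4) ∞ M],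
    ∀ ι : M → EuclideanSpace ℝ (Fin 6), Manifold.IsSmoothEmbedding (𝓡 4) (𝓡 6) ∞ ι →
      (∀ x, InCyl (ι x)) → cylEntropy (Set.range ι) < ENNReal.ofReal (1 + ε) →
      Nonempty (M ≃ₘ⟮𝓡 4, 𝓡 4⟯ Metric.sphere (0 : EuclideanSpace ℝ (Fin 5)) 1)

/-- **`M ≃ₕ S⁴` and end-separation are jointly load-bearing**: without them the EMPTY 4-manifold
(charted by the empty atlas, embedded by the empty map, cylinder entropy `0 < 1 + ε`) is a
counterexample at every threshold `ε > 0` — the entropy hypothesis alone carries no mass floor;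
the floor `λ_cyl ≥ 1` comes from separation (support item `AreaFloor`) and non-emptiness from
`M ≃ₕ S⁴`. -/
theorem sliceIsolation_false_without_homotopyEquiv_without_separation {ε : ℝ} (hε : 0 < ε) :
    ¬ SliceIsolationWithoutHomotopyEquivWithoutSeparation ε := by
  intro h
  letI : ChartedSpace (EuclideanSpace ℝ (Fin 4)) Empty := ChartedSpace.empty _ _
  let ι : Empty → EuclideanSpace ℝ (Fin 6) := fun x => x.elim
  have hemb : Manifold.IsSmoothEmbedding (𝓡 4) (𝓡 6) ∞ ι :=
    ⟨⟨PUnit, inferInstance, inferInstance, fun y => y.elim⟩, .of_subsingleton _⟩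
  have hent : cylEntropy (Set.range ι) < ENNReal.ofReal (1 + ε) := by
    rw [Set.range_eq_empty, cylEntropy_empty]
    exact ENNReal.ofReal_pos.2 (by linarith)
  obtain ⟨e⟩ := h Empty ι hemb (fun x => x.elim) hent
  exact (e.symm ⟨EuclideanSpace.single 0 1, by simp⟩).elim

/-- The crux at threshold `1 + ε` with BOTH the homotopy equivalence `M ≃ₕ S⁴` and the entropy
bound dropped. -/
def SliceIsolationWithoutHomotopyEquivWithoutEntropy : Prop :=
  ∀ (M : Type) [TopologicalSpace M] [T2Space M] [SecondCountableTopology M]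
    [ChartedSpace (EuclideanSpace ℝ (Fin 4)) M] [IsManifold (𝓡 4) ∞ M],
    ∀ ι : M → EuclideanSpace ℝ (Fin 6), Manifold.IsSmoothEmbedding (𝓡 4) (𝓡 6) ∞ ι →
      (∀ x, InCyl (ι x)) → SeparatesEnds (Set.range ι) →
      Nonempty (M ≃ₘ⟮𝓡 4, 𝓡 4⟯ Metric.sphere (0 : EuclideanSpace ℝ (Fin 5)) 1)

/-- **`M ≃ₕ S⁴` and the entropy bound are jointly load-bearing**: without them TWO SLICES
`S⁴ × {0} ⊔ S⁴ × {1}` (a smooth embedding of the disconnected closed 4-manifold `S⁴ ⊔ S⁴`,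
inside `N`, separating the ends) form a counterexample.  Separation alone bounds nothing; what
excludes this configuration in the crux is `M ≃ₕ S⁴` (connectedness) or, quantitatively, the
entropy bound (`λ_cyl` of two slices is `2`, the `τ → ∞` limit of `e^{-p₅²/4τ} + e^{-(p₅-1)²/4τ}`). -/
theorem sliceIsolation_false_without_homotopyEquiv_without_entropy :
    ¬ SliceIsolationWithoutHomotopyEquivWithoutEntropy := by
  intro h
  have hN : ∀ x, InCyl (twoSlices x) := by
    rintro (x | x) <;> exact inCyl_sliceMap _ x
  have hsep : SeparatesEnds (Set.range twoSlices) := by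
    refine separatesEnds_of_slice_subset' (c := 0) ?_
    rw [range_twoSlices]
    exact Set.subset_union_left
  obtain ⟨e⟩ := h _ twoSlices isSmoothEmbedding_twoSlices hN hsep
  exact isEmpty_diffeomorph_twoSpheres.false e

/-- The crux at threshold `1 + ε` with the smooth-embedding hypothesis on `ι` dropped (`ι` any
function `M → ℝ⁶`). -/
def SliceIsolationWithoutEmbedding (ε : ℝ) : Prop :=
  ∀ (M : Type) [TopologicalSpace M] [T2Space M] [SecondCountableTopology M]
    [ChartedSpace (EuclideanSpace ℝ (Fin 4)) M] [IsManifold (𝓡 4) ∞ M],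
    M ≃ₕ Metric.sphere (0 : EuclideanSpace ℝ (Fin 5)) 1 →
    ∀ ι : M → EuclideanSpace ℝ (Fin 6), (∀ x, InCyl (ι x)) → SeparatesEnds (Set.range ι) →
      cylEntropy (Set.range ι) < ENNReal.ofReal (1 + ε) →
      Nonempty (M ≃ₘ⟮𝓡 4, 𝓡 4⟯ Metric.sphere (0 : EuclideanSpace ℝ (Fin 5)) 1)

/-- The support item `SliceCalibration` (stmt-7634), unfolded: the typed cylinder entropy of the
slice `S⁴ × {0}` is `1` (definitional). -/
theorem sliceCalibration_iff : SliceCalibration ↔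
    cylEntropy {z : EuclideanSpace ℝ (Fin 6) | ∑ i : Fin 5, z (Fin.castSucc i) ^ 2 = 1 ∧ z 5 = 0} = 1 :=
  Iff.rfl

/-- **Without the smooth-embedding hypothesis the crux is SPC4 itself** (modulo Freedman's
theorem `M ≃ₕ S⁴ ⇒ M ≃ₜ S⁴`, tree fact `nonempty_homeomorph_sphere_four`, and the calibration
`λ_cyl(slice) = 1`, support item `SliceCalibration`): compose a homeomorphism `M ≃ₜ S⁴` with the
slice embedding — a merely continuous `ι` whose image is the slice, separating, of entropy `1`.
So the whole content of `SliceIsolation` beyond SPC4 is carried by the SMOOTHNESS of `ι`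
(equivalently: the crux is a statement about smooth submanifolds `Σ ⊂ N` with their induced
structure), and any proof must use `Manifold.IsSmoothEmbedding` essentially. -/
theorem smoothPoincare4_of_sliceIsolationWithoutEmbedding
    (hF : Literature.Topology.FourManifolds.nonempty_homeomorph_sphere_four.{0})
    (hcal : SliceCalibration) {ε : ℝ} (hε : 0 < ε) (h : SliceIsolationWithoutEmbedding ε) :
    _root_.SmoothPoincare4 := by
  unfold _root_.SmoothPoincare4 Literature.SPC4.SmoothPoincareConjectureFour
    ContinuousMap.HomotopyEquiv.NonemptyDiffeomorphSphere
  intro M _ _ _ _ _ e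
  obtain ⟨φ⟩ := hF M e
  have hr : Set.range (sliceMap 0 ∘ φ) = Set.range (sliceMap 0) := φ.surjective.range_comp _
  refine h M e (sliceMap 0 ∘ φ) (fun x => inCyl_sliceMap 0 (φ x)) ?_ ?_
  · rw [hr, range_sliceMap]
    exact separatesEnds_of_slice_subset' Set.Subset.rfl
  · rw [hr, range_sliceMap, sliceCalibration_iff.1 hcal]
    exact ENNReal.one_lt_ofReal.2 (by linarith)

/-- Conversely SPC4 gives the embedding-free variant at every threshold; hence, given Freedman and
the calibration, `SliceIsolationWithoutEmbedding ε ↔ SmoothPoincare4` for every `ε > 0`. -/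
theorem sliceIsolationWithoutEmbedding_iff_smoothPoincare4
    (hF : Literature.Topology.FourManifolds.nonempty_homeomorph_sphere_four.{0})
    (hcal : SliceCalibration) {ε : ℝ} (hε : 0 < ε) :
    SliceIsolationWithoutEmbedding ε ↔ _root_.SmoothPoincare4 := by
  refine ⟨smoothPoincare4_of_sliceIsolationWithoutEmbedding hF hcal hε, fun hs => ?_⟩
  unfold _root_.SmoothPoincare4 Literature.SPC4.SmoothPoincareConjectureFour
    ContinuousMap.HomotopyEquiv.NonemptyDiffeomorphSphere at hs
  intro M _ _ _ _ _ e ι _ _ _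
  exact hs M ‹_› ‹_› e

end LoadBearing

/-! ### Non-vacuity of the crux reduces to the calibration -/

section NonVacuity

/-- **The hypotheses of the crux are satisfiable** (so it is not vacuously true) as soon as the
support item `SliceCalibration` holds: the slice `S⁴ × {0}` is a smooth embedding of the standard
`S⁴` into `N`, separating the ends, with cylinder entropy `1 < 1 + ε`.  Unconditionally the first
three hypotheses hold (`isSmoothEmbedding_sliceMap`, `inCyl_sliceMap`,
`separatesEnds_of_slice_subset`); only the value of the typed entropy of the slice is delegated. -/
theorem crux_hypotheses_hold_for_slice (hcal : SliceCalibration) {ε : ℝ} (hε : 0 < ε) :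
    Manifold.IsSmoothEmbedding (𝓡 4) (𝓡 6) ∞ (sliceMap 0) ∧ (∀ x, InCyl (sliceMap 0 x)) ∧
      SeparatesEnds (Set.range (sliceMap 0)) ∧
      cylEntropy (Set.range (sliceMap 0)) < ENNReal.ofReal (1 + ε) := by
  refine ⟨isSmoothEmbedding_sliceMap 0, inCyl_sliceMap 0, ?_, ?_⟩
  · rw [range_sliceMap]
    exact separatesEnds_of_slice_subset' Set.Subset.rfl
  · rw [range_sliceMap, sliceCalibration_iff.1 hcal]
    exact ENNReal.one_lt_ofReal.2 (by linarith)

end NonVacuity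

/-! ### Near-misses (sorried; the obstruction is in each docstring) and the tightness corollary -/

section NearMisses

/-- The crux at threshold `1 + ε` with ONLY the homotopy equivalence `M ≃ₕ S⁴` dropped. -/
def SliceIsolationWithoutHomotopyEquiv (ε : ℝ) : Prop :=
  ∀ (M : Type) [TopologicalSpace M] [T2Space M] [SecondCountableTopology M]
    [ChartedSpace (EuclideanSpace ℝ (Fin 4)) M] [IsManifold (𝓡 4) ∞ M],
    ∀ ι : M → EuclideanSpace ℝ (Fin 6), Manifold.IsSmoothEmbedding (𝓡 4) (𝓡 6) ∞ ι →
      (∀ x, InCyl (ι x)) → SeparatesEnds (Set.range ι) →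
      cylEntropy (Set.range ι) < ENNReal.ofReal (1 + ε) →
      Nonempty (M ≃ₘ⟮𝓡 4, 𝓡 4⟯ Metric.sphere (0 : EuclideanSpace ℝ (Fin 5)) 1)

/-- **NEAR-MISS (load-bearing analysis of `M ≃ₕ S⁴` alone).**  Claim: for EVERY `ε > 0` the variant
without the homotopy equivalence is false.  Witness ("slice ⊔ dust"): `M = S⁴ ⊔ B⁴` (open 4-ball, so `M`
is disconnected and non-compact, hence not `≅ S⁴`), `ι = sliceMap 0 ⊔ (flat disc of radius r inside the
slice at height δ)`, with `r ≪ δ ≪ 1`.  On paper `λ_cyl ≤ 1 + max (e^{-δ²/16τ₀}, C·r⁴/τ₀²)` for any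
`τ₀ ≤ δ²`: centres with `p₅ ≤ δ/2` see the disc only through `e^{-(δ-p₅)²/4τ}`, centres with `p₅ ≥ δ/2`
see the slice only through `e^{-p₅²/4τ}` (both `≤ e^{-δ²/16τ}`), a piece of a slice has density `≤ 1`
(calibration), and at scales `τ ≥ τ₀` the disc contributes `≤ area · sup 𝔥(τ,·)/vol(S⁴) ≤ C r⁴ τ₀⁻²`.
For `ε > λ(S⁴) - 1 ≈ 0.44` a compact witness also works (slice ⊔ tiny round `S⁴`).
Obstruction to a Lean proof (what was tried: nothing beyond locating the tools): (i) the calibration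
`F̂_{p,τ}(slice at height c) = e^{-(c-p₅)²/4τ} ≤ 1` = the "≤" half of support item `SliceCalibration`
(Funk–Hecke for the zonal Gegenbauer modes against `μH[4]` on `S⁴`; the tree identifies `μH[d]` on spheres
with the rotation-invariant surface measure in `Literature/MeasureTheory/Hausdorff/SphereMeasure.lean`,
`SphereRotationInvariance.lean`, but no Funk–Hecke / zonal-integral formula exists); (ii) the sup bound
`𝔥(τ, s) ≤ C (1 + τ⁻²)` of the typed series; (iii) an `IsSmoothEmbedding` lemma for `closed ⊔ open`
summands with disjoint closures (the tree's `sumElim` wants both domains compact).  Consequence for provers: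
the hypothesis `M ≃ₕ S⁴` is used by NO step of the intended mechanism for connected closed `M`
(ε-regularity ⇒ graph over a slice ⇒ `S⁴`); it only excludes disconnected / non-compact junk like this. -/
theorem sliceIsolation_false_without_homotopyEquiv {ε : ℝ} (hε : 0 < ε) :
    ¬ SliceIsolationWithoutHomotopyEquiv ε := by
  sorry

/-- **NEAR-MISS (no gap in the VALUES of `λ_cyl` on standard spheres).**  For every `δ > 0` there is a
smoothly embedded separating cross-section of `S⁴` itself (a small graph `t = a·cos θ` over the slice) with
`1 < λ_cyl < 1 + δ`; numerically (kit job j004944, `results.json` check 5) `sup F̂ - 1` decays like `a²`.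
So the isolation asserted by the crux is TOPOLOGICAL (only exotic `M` are kept away from `1`), not a gap in
the range of the functional; any proof must convert small entropy into GRAPHICALITY (ε-regularity at scales
up to `inj(N) = π`), never into `λ_cyl = 1`.  Obstruction to a Lean proof: evaluating the typed functional on
any non-slice set (same tools as the calibration). -/
theorem exists_crossSection_entropy_near_one {δ : ℝ} (hδ : 0 < δ) :
    ∃ ι : Metric.sphere (0 : EuclideanSpace ℝ (Fin 5)) 1 → EuclideanSpace ℝ (Fin 6),
      Manifold.IsSmoothEmbedding (𝓡 4) (𝓡 6) ∞ ι ∧ (∀ x, InCyl (ι x)) ∧ SeparatesEnds (Set.range ι) ∧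
      1 < cylEntropy (Set.range ι) ∧ cylEntropy (Set.range ι) < ENNReal.ofReal (1 + δ) := by
  sorry

end NearMisses

end Summit.SmoothPoincare4.SmoothPoincare4.Cruxes.SliceIsolation.Disproof
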